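import Summits.AtomisticToContinuum.Crystallization.Theorems.HullExactificationCascadeRobustBarlowTemplateDevelopTransfer
import Summits.AtomisticToContinuum.Crystallization.Theorems.PalmUnimodularRigidityShellsToBarlowChartTransportSteps1

/-!
# Line `registered` (crux `RobustBarlowTemplate`, stmt-AtomisticToContinuum-12088): the four in-layer transports `I, J, I⁻¹, J⁻¹` and the vertical transport `V` of frames read in scale-relative integer charts (specifications, inverse identities, apexes) (part 1/7)

Helper lemmas for `develop_transport` (the geometric half of the development): frames
`⟨x, t₁, t₂, U⟩` read in the scale-relative integer charts `IsZChart` of an everywhere-good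
configuration, their transports and the coherence of the resulting development `frameAt`.  The
only metric inputs are the chart transfer lemma `develop_transfer` and `bond_nb_iff`; everything
else is label combinatorics in `ℤ³` (pattern facts `TransportPatterns*` of the sibling crux 9227,
imported verbatim).  All `[folklore]` (HalesDSP2012 §1.3 for the two kissing patterns).

This file is a PORT of `PalmUnimodularRigidityShellsToBarlowChartTransportSteps1.lean` (closed
sibling crux `ShellsToBarlowChart`, stmt-9227) to the vocabulary of this crux, with ONE change:
the bond relation is no longer the fixed window `0 < dist x y ∧ dist x y ≤ 28/25` but the
SCALE-RELATIVE shell relation `y ∈ shell S x` (`…RobustBarlowTemplateDefs`), and the charts are the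
five-argument `IsZChart S x P A nbr` of `…RobustBarlowTemplateTransportDefs` (no scale argument).
The frame operations `ZFrame, zlab, capWith, capOpp, capWithAny, Istep, IinvStep, Jstep, JinvStep,
apexOf, lowerParity, lowerCap, Vstep, VinvStep, zIter, frameAt` are those of
`…ShellsToBarlowChartTransportOpsDefs` (chart-agnostic, imported, not copied), the pattern facts
are `…ShellsToBarlowChartTransportPatterns1–14` and the two chart-agnostic rewriting lemmas
`mem_hexLabels_iff`, `mem_lowerCap_iff` are those of `…ShellsToBarlowChartTransportSteps1` (all
three imported through the latter; the gate forbids restating landed declarations).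

## Port notes (rules followed here and by the later parts `Steps2–7, Lower, Vinv, Attach, Comm,
VComm, LayerZero, Global*`)

* standing hypothesis `hch : ∀ z ∈ S, IsZChart S z (Pc z) (Ac z) (nb z)` (the scale family `ac`
  of 9227 is gone, also from the `variable` line); conjunct paths `.1` pattern / `.2.1` `BijOn` /
  `.2.2.1` estimate / `.2.2.2` links (9227: `.1 / .2.2.2.1 / .2.2.2.2.1 / .2.2.2.2.2`);
* a bond `0 < dist a b ∧ dist a b ≤ 28/25` (hypothesis, conclusion or set-builder) becomes
  `b ∈ shell S a` (resp. the set `shell S a`); signatures are kept PARALLEL to the source, in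
  particular the now-redundant memberships `(hy : y ∈ S)` next to `(hxy : y ∈ shell S x)` are KEPT
  (so call sites port verbatim; `hxy.1` would do);
* the shell relation is not symmetric for free: `bond_symm h` (9227) becomes an appeal
  `hsy a ha b h` to the NEW standing hypothesis
  `hsy : ∀ x ∈ S, ∀ y ∈ shell S x, x ∈ shell S y`, threaded right after `hch` through every lemma
  whose proof needs symmetry (here: `transfer_nb_nb`, `transfer_nb_centre`, `transfer_nb_target`,
  `sqNormInt_zlab_centre`, `hcp_of_mirror_pair`; pass it at the call sites);
* `scales_tied` lines are deleted and `sqNormInt_transfer hx hy htie.1 htie.2 hz hz' hu hu'`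
  becomes `zchart_transfer hx hy hyx hxy hz hz' hu hu'` (`hyx : y ∈ shell S x`,
  `hxy : x ∈ shell S y`), a thin implicit-argument wrapper of the landed `develop_transfer`;
* `(hch x hx).sqNormInt_eq ht` (9227 `IsZChart.sqNormInt_eq`) becomes
  `zchart_sqNormInt_eq (hch x hx) ht`;
* theorem names are those of the source (different namespace): inside this namespace OUR
  declaration shadows the 9227 one of the same name (Lean resolves through the current namespace
  before the `open`ed ones), and the `open … hiding …` line below moreover hides the 9227 chart
  vocabulary `IsZChart TransportSystem scales_tied sqNormInt_transfer bond_symm` and the 9227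
  versions of the lemmas of this file — COPY that `open` line into every later part;
* `mem_hexLabels_iff`, `mem_lowerCap_iff` are NOT re-proved (used from 9227 `TransportSteps1`).
-/

noncomputable section

namespace Summit.AtomisticToContinuum.Crystallization.Theorems.HullExactificationCascadeRobustBarlowTemplate

open Literature.Geometry.DiscreteGeometry Literature.MathematicalPhysics.StatisticalMechanics
open Summit.AtomisticToContinuum.Crystallization.Theorems.PalmUnimodularRigidityShellsToBarlowChart hiding
  IsZChart TransportSystem scales_tied sqNormInt_transfer bond_symm nb_mem zlab_spec zlab_nb bond_nb_iff
  pattern_cases transfer_nb_nb transfer_nb_centre transfer_nb_target sqNormInt_zlab_centre hcp_of_mirror_pair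

variable {S : Set (EuclideanSpace ℝ (Fin 3))} {Pc : (EuclideanSpace ℝ (Fin 3)) → Finset (Fin 3 → ℤ)}
  {Ac : (EuclideanSpace ℝ (Fin 3)) → ((EuclideanSpace ℝ (Fin 3)) →ₗᵢ[ℝ] (EuclideanSpace ℝ (Fin 3)))}
  {nb : (EuclideanSpace ℝ (Fin 3)) → (Fin 3 → ℤ) → (EuclideanSpace ℝ (Fin 3))}

/-! ## Chart API (local versions of the 9227 `IsZChart.*` lemmas) -/

/-- Labels of a scale-relative integer chart have squared norm `18` (9227:
`IsZChart.sqNormInt_eq`). [folklore] -/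
theorem zchart_sqNormInt_eq {x : EuclideanSpace ℝ (Fin 3)} {P : Finset (Fin 3 → ℤ)}
    {A : (EuclideanSpace ℝ (Fin 3)) →ₗᵢ[ℝ] (EuclideanSpace ℝ (Fin 3))}
    {nbr : (Fin 3 → ℤ) → EuclideanSpace ℝ (Fin 3)} (h : IsZChart S x P A nbr) {t : Fin 3 → ℤ}
    (ht : t ∈ P) : sqNormInt t = 18 := by
  rcases h.1 with rfl | rfl
  · exact sqNormInt_of_mem_fcc3Int t ht
  · exact sqNormInt_of_mem_hcpInt t ht

/-- **The chart transfer lemma** (the landed `develop_transfer`, implicit-argument form; 9227: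
`sqNormInt_transfer`): for two mutually shell-adjacent charted sites `x, y` and two points each of
which is `x` (label `0`) or a labelled shell point of `x`, AND `y` or a labelled shell point of
`y`, the squared label distance read at `y` is the one read at `x`. [folklore] -/
theorem zchart_transfer {x y : EuclideanSpace ℝ (Fin 3)} {P Py : Finset (Fin 3 → ℤ)}
    {A Ay : (EuclideanSpace ℝ (Fin 3)) →ₗᵢ[ℝ] (EuclideanSpace ℝ (Fin 3))}
    {nbr ny : (Fin 3 → ℤ) → EuclideanSpace ℝ (Fin 3)} (hx : IsZChart S x P A nbr)
    (hy : IsZChart S y Py Ay ny) (hyx : y ∈ shell S x) (hxy : x ∈ shell S y)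
    {z z' : EuclideanSpace ℝ (Fin 3)} {t t' u u' : Fin 3 → ℤ}
    (hz : (t = 0 ∧ z = x) ∨ (t ∈ P ∧ z = nbr t)) (hz' : (t' = 0 ∧ z' = x) ∨ (t' ∈ P ∧ z' = nbr t'))
    (hu : (u = 0 ∧ z = y) ∨ (u ∈ Py ∧ z = ny u)) (hu' : (u' = 0 ∧ z' = y) ∨ (u' ∈ Py ∧ z' = ny u')) :
    sqNormInt (u - u') = sqNormInt (t - t') :=
  develop_transfer S x y P Py A Ay nbr ny hx hy hyx hxy z z' t t' u u' hz hz' hu hu'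

/-- A labelled neighbour is a site of `S` in the shell of the centre. [folklore] -/
theorem nb_mem (hch : ∀ z ∈ S, IsZChart S z (Pc z) (Ac z) (nb z)) {x : (EuclideanSpace ℝ (Fin 3))} (hx : x ∈ S)
    {t : Fin 3 → ℤ} (ht : t ∈ Pc x) : nb x t ∈ S ∧ nb x t ∈ shell S x :=
  ⟨((hch x hx).2.1.mapsTo ht).1, (hch x hx).2.1.mapsTo ht⟩

/-- The inverse labelling of a shell point is a label and labels it. [folklore] -/
theorem zlab_spec (hch : ∀ z ∈ S, IsZChart S z (Pc z) (Ac z) (nb z)) {y z : (EuclideanSpace ℝ (Fin 3))} (hy : y ∈ S)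
    (hz : z ∈ S) (hb : z ∈ shell S y) :
    zlab Pc nb y z ∈ Pc y ∧ nb y (zlab Pc nb y z) = z := by
  have hbij := (hch y hy).2.1
  have hmem : z ∈ shell S y := ⟨hz, hb.2⟩
  obtain ⟨t, ht, htz⟩ := hbij.surjOn hmem
  have hex : ∃ t ∈ (↑(Pc y) : Set (Fin 3 → ℤ)), nb y t = z := ⟨t, ht, htz⟩
  exact ⟨Function.invFunOn_mem hex, Function.invFunOn_eq hex⟩

/-- The inverse labelling inverts the labelling on labels. [folklore] -/
theorem zlab_nb (hch : ∀ z ∈ S, IsZChart S z (Pc z) (Ac z) (nb z)) {y : (EuclideanSpace ℝ (Fin 3))} (hy : y ∈ S)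
    {t : Fin 3 → ℤ} (ht : t ∈ Pc y) : zlab Pc nb y (nb y t) = t :=
  (hch y hy).2.1.invOn_invFunOn.1 ht

/-- Shell-adjacencies among labelled neighbours are the label pairs at squared distance `18`.
[folklore] -/
theorem bond_nb_iff (hch : ∀ z ∈ S, IsZChart S z (Pc z) (Ac z) (nb z)) {x : (EuclideanSpace ℝ (Fin 3))} (hx : x ∈ S)
    {t t' : Fin 3 → ℤ} (ht : t ∈ Pc x) (ht' : t' ∈ Pc x) :
    nb x t' ∈ shell S (nb x t) ↔ sqNormInt (t - t') = 18 :=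
  (hch x hx).2.2.2 t ht t' ht'

/-- The pattern of a chart is FCC or HCP. [folklore] -/
theorem pattern_cases (hch : ∀ z ∈ S, IsZChart S z (Pc z) (Ac z) (nb z)) {x : (EuclideanSpace ℝ (Fin 3))} (hx : x ∈ S) :
    Pc x = fcc3Int ∨ Pc x = hcpInt := (hch x hx).1

/-- **Transfer for two labelled neighbours of `x`** that are also shell points of the shell point
`y` of `x`: their squared label distance at `y` is the one at `x`. [folklore] -/
theorem transfer_nb_nb (hch : ∀ z ∈ S, IsZChart S z (Pc z) (Ac z) (nb z))
    (hsy : ∀ x ∈ S, ∀ y ∈ shell S x, x ∈ shell S y) {x y : (EuclideanSpace ℝ (Fin 3))}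
    (hx : x ∈ S) (hy : y ∈ S) (hxy : y ∈ shell S x)
    {t t' : Fin 3 → ℤ} (ht : t ∈ Pc x) (ht' : t' ∈ Pc x)
    (hzt : nb x t ∈ shell S y) (hzt' : nb x t' ∈ shell S y) :
    sqNormInt (zlab Pc nb y (nb x t) - zlab Pc nb y (nb x t')) = sqNormInt (t - t') := by
  have h1 := zlab_spec hch hy (nb_mem hch hx ht).1 hzt
  have h2 := zlab_spec hch hy (nb_mem hch hx ht').1 hzt'
  exact zchart_transfer (hch x hx) (hch y hy) hxy (hsy x hx y hxy) (Or.inr ⟨ht, rfl⟩) (Or.inr ⟨ht', rfl⟩)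
    (Or.inr ⟨h1.1, h1.2.symm⟩) (Or.inr ⟨h2.1, h2.2.symm⟩)

/-- **Transfer for a labelled neighbour of `x` and `x` itself**, read at the shell point `y`:
`D(label of z, label of x) = sqNormInt t`. [folklore] -/
theorem transfer_nb_centre (hch : ∀ z ∈ S, IsZChart S z (Pc z) (Ac z) (nb z))
    (hsy : ∀ x ∈ S, ∀ y ∈ shell S x, x ∈ shell S y) {x y : (EuclideanSpace ℝ (Fin 3))}
    (hx : x ∈ S) (hy : y ∈ S) (hxy : y ∈ shell S x)
    {t : Fin 3 → ℤ} (ht : t ∈ Pc x) (hzt : nb x t ∈ shell S y) :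
    sqNormInt (zlab Pc nb y (nb x t) - zlab Pc nb y x) = sqNormInt t := by
  have hyx : x ∈ shell S y := hsy x hx y hxy
  have h1 := zlab_spec hch hy (nb_mem hch hx ht).1 hzt
  have h2 := zlab_spec hch hy hx hyx
  have := zchart_transfer (hch x hx) (hch y hy) hxy hyx (Or.inr ⟨ht, rfl⟩) (Or.inl ⟨rfl, rfl⟩)
    (Or.inr ⟨h1.1, h1.2.symm⟩) (Or.inr ⟨h2.1, h2.2.symm⟩)
  rw [this, sub_zero]

/-- **Transfer for a labelled neighbour of `x` and `y` itself** (`y = nb x t₀`): the label of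
`nb x t` at `y` has `sqNormInt = sqNormInt (t − t₀)`. [folklore] -/
theorem transfer_nb_target (hch : ∀ z ∈ S, IsZChart S z (Pc z) (Ac z) (nb z))
    (hsy : ∀ x ∈ S, ∀ y ∈ shell S x, x ∈ shell S y) {x : (EuclideanSpace ℝ (Fin 3))}
    (hx : x ∈ S) {t₀ t : Fin 3 → ℤ} (ht₀ : t₀ ∈ Pc x) (ht : t ∈ Pc x)
    (hzt : nb x t ∈ shell S (nb x t₀)) :
    sqNormInt (zlab Pc nb (nb x t₀) (nb x t)) = sqNormInt (t - t₀) := by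
  have hy := nb_mem hch hx ht₀
  have hyx : x ∈ shell S (nb x t₀) := hsy x hx _ hy.2
  have h1 := zlab_spec hch hy.1 (nb_mem hch hx ht).1 hzt
  have := zchart_transfer (hch x hx) (hch _ hy.1) hy.2 hyx (Or.inr ⟨ht, rfl⟩) (Or.inr ⟨ht₀, rfl⟩)
    (Or.inr ⟨h1.1, h1.2.symm⟩) (Or.inl ⟨rfl, rfl⟩)
  rw [sub_zero] at this
  exact this

/-- The label of the centre `x` at a labelled neighbour `y = nb x t₀` has squared norm `18`.
[folklore] -/
theorem sqNormInt_zlab_centre (hch : ∀ z ∈ S, IsZChart S z (Pc z) (Ac z) (nb z))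
    (hsy : ∀ x ∈ S, ∀ y ∈ shell S x, x ∈ shell S y) {x : (EuclideanSpace ℝ (Fin 3))}
    (hx : x ∈ S) {t₀ : Fin 3 → ℤ} (ht₀ : t₀ ∈ Pc x) :
    sqNormInt (zlab Pc nb (nb x t₀) x) = 18 := by
  have hy := nb_mem hch hx ht₀
  have h := zlab_spec hch hy.1 hx (hsy x hx _ hy.2)
  exact zchart_sqNormInt_eq (hch _ hy.1) h.1


/-! ## The in-layer steps -/

/-- **The mirror-pair argument** (regime B): if the source pattern of a valid frame is HCP then,
at the neighbour `y = nb x t` for a hexagon label `t`, the labels of `x` and of any common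
neighbour touching the transported upper AND lower cap images are equatorial, and `y` is HCP.
Stated for the data actually used: two common neighbours `u = nb x cu`, `l = nb x cl` of `x, y`
with `sqNormInt (cu − cl) = 48` force `Pc y = hcpInt`, and a label at `y` touching both of
their labels is equatorial. [folklore] -/
theorem hcp_of_mirror_pair (hch : ∀ z ∈ S, IsZChart S z (Pc z) (Ac z) (nb z))
    (hsy : ∀ x ∈ S, ∀ y ∈ shell S x, x ∈ shell S y) {x : (EuclideanSpace ℝ (Fin 3))}
    (hx : x ∈ S) {t cu cl : Fin 3 → ℤ} (ht : t ∈ Pc x) (hcu : cu ∈ Pc x) (hcl : cl ∈ Pc x)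
    (h48 : sqNormInt (cu - cl) = 48)
    (hbu : nb x cu ∈ shell S (nb x t)) (hbl : nb x cl ∈ shell S (nb x t)) :
    Pc (nb x t) = hcpInt ∧
      ∀ q ∈ Pc (nb x t), sqNormInt (q - zlab Pc nb (nb x t) (nb x cu)) = 18 →
        sqNormInt (q - zlab Pc nb (nb x t) (nb x cl)) = 18 → -q ∈ Pc (nb x t) := by
  have hy := nb_mem hch hx ht
  have hμ := zlab_spec hch hy.1 (nb_mem hch hx hcu).1 hbu
  have hlam := zlab_spec hch hy.1 (nb_mem hch hx hcl).1 hbl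
  have D : sqNormInt (zlab Pc nb (nb x t) (nb x cu) - zlab Pc nb (nb x t) (nb x cl)) = 48 := by
    rw [transfer_nb_nb hch hsy hx hy.1 hy.2 hcu hcl hbu hbl, h48]
  have hPy : Pc (nb x t) = hcpInt := by
    rcases pattern_cases hch hy.1 with h | h
    · exfalso
      rw [h] at hμ hlam
      exact sqNormInt_sub_ne_48_of_fcc3Int _ hμ.1 _ hlam.1 D
    · exact h
  refine ⟨hPy, fun q hq h1 h2 => ?_⟩
  rw [hPy] at hq hμ hlam ⊢
  exact neg_mem_of_mirror_pair q hq _ hμ.1 _ hlam.1 h1 h2 D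

/-! ## Anchor -/

/-- Anchor (registered sub-goal of stmt-AtomisticToContinuum-12088): in a charted configuration
the pattern of every chart is FCC or HCP. [folklore] -/
theorem transportSteps1_anchor : ∀ (S : Set (EuclideanSpace ℝ (Fin 3))) (Pc : EuclideanSpace ℝ (Fin 3) → Finset (Fin 3 → ℤ)) (Ac : EuclideanSpace ℝ (Fin 3) → (EuclideanSpace ℝ (Fin 3) →ₗᵢ[ℝ] EuclideanSpace ℝ (Fin 3))) (nb : EuclideanSpace ℝ (Fin 3) → (Fin 3 → ℤ) → EuclideanSpace ℝ (Fin 3)), (∀ z ∈ S, IsZChart S z (Pc z) (Ac z) (nb z)) → ∀ x ∈ S, Pc x = fcc3Int ∨ Pc x = hcpInt :=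
  fun _ _ _ _ hch _ hx => pattern_cases hch hx

end Summit.AtomisticToContinuum.Crystallization.Theorems.HullExactificationCascadeRobustBarlowTemplate

end
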